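import Summits.PneNP.PneNP.Theorems.OneSliceConstantBandSliceLemma23Aux

/-!
# Route OneSlice, crux `ConstantBand` (stmt-PneNP-2834), line `flat-prior-relative-minterms`:
# slice Lemma 23 (S1) — the second moment of `ω_k` on a slice and the fibre bound

Helper file 2/3 for the stub `stub_sliceLemma23` (the SLICE form of Rossman FOCS'10 Lemma 23). With
`K = C(k,2)`, `N = C(n,2)`, `θ = n^{-2/(k-1)}`, `ω_k(y) = #{A ∈ ([n] choose k) : K_A ⊆ y}`:

* §7 `l23_card_filter_cliqueVec_or` (`|K_A ∪ K_B| = K + (K - C(|A∩B|,2))`), `l23_secondMoment_le`: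
  `Σ_{y ∈ slice_m} ω_k(y)² ≤ #slice_m · (m/N)^K · C(n,k) · (1 + k·2^k·b^K)` whenever `m/N ≤ b·θ` — the
  hypergeometric tail on the slice plus the overlap series `sum_erase_pow_inter_le` of
  `Literature/…/CliqueThresholdBounds.lean` (Rossman FOCS'10, App. B, proof of Lemma 23 (a));
* §8 `l23_ratio_le` (`#slice_{i+K}²·((i+K)/N)^K ≤ 2^K·2^K·2^k·k!·#slice_i²·C(n,k)` in the central regime) and
  `l23_fibre_bound`: for `Q ⊆ slice_{i+K}`,
  `(Σ_{y∈Q} ω_k(y)) / (#slice_i · C(n,k)) ≤ √(L_k · #Q/#slice_{i+K})`,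
  `L_k = (1 + k·2^k·2^K)·(2^K·2^K·2^k·k!)` (Cauchy–Schwarz).

[folklore]
-/

noncomputable section

namespace Summit.PneNP.PneNP.Cruxes.ConstantBand.FlatPriorRelativeMinterms

open Literature.Computability.Complexity Filter Classical
open Finset hiding slice
open Summit.PneNP.PneNP.Theorems.ConstantBand.Negative

set_option linter.dupNamespace false

variable {n : ℕ}

/-! ## §7 The second moment of the clique count `ω_k` on a slice -/

/-- `K_A ∪ K_B` has `C(|A|,2) + (C(|B|,2) - C(|A ∩ B|,2))` edges. [folklore] -/
theorem l23_card_filter_cliqueVec_or (A B : Finset (Fin n)) :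
    #(univ.filter fun e : Edge n => cliqueVec A e = true ∨ cliqueVec B e = true) =
      (#A).choose 2 + ((#B).choose 2 - (#(A ∩ B)).choose 2) := by
  rw [← card_filter_cliqueVec A, ← card_filter_cliqueVec_and_not A B, ← card_union_of_disjoint]
  · congr 1
    ext e
    simp only [mem_filter, mem_univ, true_and, mem_union]
    constructor
    · rintro (h | h)
      · exact Or.inl h
      · cases hA : cliqueVec A e with
        | true => exact Or.inl rfl
        | false => exact Or.inr ⟨h, rfl⟩
    · rintro (h | ⟨h, -⟩)
      · exact Or.inl h
      · exact Or.inr h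
  · rw [disjoint_left]
    intro e he he'
    rw [mem_filter] at he he'
    have h := he'.2.2
    rw [he.2] at h
    exact Bool.noConfusion h

/-- **Second moment of `ω_k` on a slice.** For `k ≥ 2`, `n ≥ 2`, `m ≤ C(n,2)` and
`p := m / C(n,2) ≤ b · n^{-2/(k-1)}` (`b ≥ 1`):
`Σ_{y ∈ slice_m} ω_k(y)² ≤ #slice_m · p^{C(k,2)} · C(n,k) · (1 + k·2^k·b^{C(k,2)})` — expand the square
as a sum over pairs `(A, B)` of `k`-sets, bound `#{y : K_A ∪ K_B ⊆ y}` by the hypergeometric tail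
`p^{|K_A ∪ K_B|} = p^{C(k,2)} · p^{C(k,2) - C(|A∩B|,2)}`, and sum the overlap series with
`sum_erase_pow_inter_le` (Rossman FOCS'10, App. B, proof of Lemma 23 (a), on the slice). [folklore] -/
theorem l23_secondMoment_le {k m : ℕ} (hk : 2 ≤ k) (hn : 2 ≤ n) (hm : m ≤ n.choose 2) {b : ℝ}
    (hb : 1 ≤ b) (hpb : (m : ℝ) / n.choose 2 ≤ b * (n : ℝ) ^ (-(2 : ℝ) / ((k : ℝ) - 1))) :
    ∑ y ∈ slice n m, (#((powersetCard k (univ : Finset (Fin n))).filter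
        fun A => ∀ e, cliqueVec A e = true → y e = true) : ℝ) ^ 2 ≤
      #(slice n m) * ((m : ℝ) / n.choose 2) ^ k.choose 2 *
        (n.choose k * (1 + k * 2 ^ k * b ^ k.choose 2)) := by
  set S := slice n m with hS
  set 𝒜 := powersetCard k (univ : Finset (Fin n)) with h𝒜
  set p : ℝ := (m : ℝ) / n.choose 2 with hp
  have hN : 0 < n.choose 2 := Nat.choose_pos hn
  have hp0 : 0 ≤ p := by positivity
  set P : Finset (Fin n) → (Edge n → Bool) → Prop :=
    fun A y => ∀ e, cliqueVec A e = true → y e = true with hP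
  -- Step 1: the square of the clique count is a double indicator sum
  have h1 : ∀ y : Edge n → Bool, (#(𝒜.filter fun A => P A y) : ℝ) ^ 2 =
      ∑ A ∈ 𝒜, ∑ B ∈ 𝒜, if P A y ∧ P B y then (1 : ℝ) else 0 := by
    intro y
    rw [← sum_product' 𝒜 𝒜 (fun A B => if P A y ∧ P B y then (1 : ℝ) else 0), sum_boole,
      filter_product (fun A => P A y) (fun B => P B y), card_product, Nat.cast_mul, sq]
  -- Step 2: for a fixed pair `(A, B)` the hypergeometric tail
  have h2 : ∀ A ∈ 𝒜, ∀ B ∈ 𝒜, (#(S.filter fun y => P A y ∧ P B y) : ℝ) ≤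
      p ^ k.choose 2 * p ^ (k.choose 2 - (#(A ∩ B)).choose 2) * #S := by
    intro A hA B hB
    have hAk := (mem_powersetCard.1 hA).2
    have hBk := (mem_powersetCard.1 hB).2
    set F := univ.filter fun e : Edge n => cliqueVec A e = true ∨ cliqueVec B e = true with hF
    have hFcard : #F = k.choose 2 + (k.choose 2 - (#(A ∩ B)).choose 2) := by
      rw [hF, l23_card_filter_cliqueVec_or, hAk, hBk]
    have heq : (S.filter fun y => P A y ∧ P B y) = S.filter fun y => ∀ e ∈ F, y e = true := by
      refine filter_congr fun y _ => ?_
      simp only [hP, hF, mem_filter, mem_univ, true_and]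
      constructor
      · rintro ⟨h₁, h₂⟩ e (he | he)
        exacts [h₁ e he, h₂ e he]
      · intro h
        exact ⟨fun e he => h e (Or.inl he), fun e he => h e (Or.inr he)⟩
    rw [heq, ← pow_add, ← hFcard]
    exact l23_card_slice_filter_supset_le_real F hm hN
  -- Step 3: the overlap series
  have h3 : ∀ A ∈ 𝒜, ∑ B ∈ 𝒜, p ^ (k.choose 2 - (#(A ∩ B)).choose 2) ≤
      1 + k * 2 ^ k * b ^ k.choose 2 := by
    intro A hA
    have hAk := (mem_powersetCard.1 hA).2
    rw [← add_sum_erase 𝒜 _ hA, inter_self, hAk, Nat.sub_self, pow_zero]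
    exact add_le_add le_rfl (sum_erase_pow_inter_le hk (by omega) hp0 hb hpb hA)
  -- assemble
  calc ∑ y ∈ S, (#(𝒜.filter fun A => P A y) : ℝ) ^ 2
      = ∑ y ∈ S, ∑ A ∈ 𝒜, ∑ B ∈ 𝒜, (if P A y ∧ P B y then (1 : ℝ) else 0) :=
        sum_congr rfl fun y _ => h1 y
    _ = ∑ A ∈ 𝒜, ∑ B ∈ 𝒜, ∑ y ∈ S, (if P A y ∧ P B y then (1 : ℝ) else 0) := by
        rw [sum_comm]
        exact sum_congr rfl fun A _ => sum_comm
    _ = ∑ A ∈ 𝒜, ∑ B ∈ 𝒜, (#(S.filter fun y => P A y ∧ P B y) : ℝ) := by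
        refine sum_congr rfl fun A _ => sum_congr rfl fun B _ => ?_
        rw [sum_boole]
    _ ≤ ∑ A ∈ 𝒜, ∑ B ∈ 𝒜, p ^ k.choose 2 * p ^ (k.choose 2 - (#(A ∩ B)).choose 2) * #S :=
        sum_le_sum fun A hA => sum_le_sum fun B hB => h2 A hA B hB
    _ = #S * p ^ k.choose 2 * ∑ A ∈ 𝒜, ∑ B ∈ 𝒜, p ^ (k.choose 2 - (#(A ∩ B)).choose 2) := by
        rw [mul_sum]
        refine sum_congr rfl fun A _ => ?_
        rw [mul_sum]
        exact sum_congr rfl fun B _ => by ring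
    _ ≤ #S * p ^ k.choose 2 * ∑ _A ∈ 𝒜, (1 + k * 2 ^ k * b ^ k.choose 2) :=
        mul_le_mul_of_nonneg_left (sum_le_sum h3) (by positivity)
    _ = #S * p ^ k.choose 2 * (n.choose k * (1 + k * 2 ^ k * b ^ k.choose 2)) := by
        rw [sum_const, card_powersetCard, card_univ, Fintype.card_fin, nsmul_eq_mul]

/-- **Registered sub-goal of the second-moment file** (`∀`-form of `l23_secondMoment_le`, stub
`l23_moment_pkg` on stmt-PneNP-2834). [folklore] -/
theorem l23_moment_pkg : ∀ n k m : ℕ, ∀ b : ℝ, 2 ≤ k → 2 ≤ n → m ≤ n.choose 2 → 1 ≤ b →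
    (m : ℝ) / n.choose 2 ≤ b * (n : ℝ) ^ (-(2 : ℝ) / ((k : ℝ) - 1)) →
      ∑ y ∈ slice n m, (#((powersetCard k (univ : Finset (Fin n))).filter
          fun A => ∀ e, cliqueVec A e = true → y e = true) : ℝ) ^ 2 ≤
        #(slice n m) * ((m : ℝ) / n.choose 2) ^ k.choose 2 * (n.choose k * (1 + k * 2 ^ k * b ^ k.choose 2)) :=
  fun _ _ _ _ hk hn hm hb hpb => l23_secondMoment_le hk hn hm hb hpb

/-! ## §8 The slice ratio at the planted shift and the fibre bound -/

/-- **Ratio of slice sizes at the planted shift.** For `K = C(k,2) ≤ i`, `i + K ≤ C(n,2)`, `n ≥ 2k` and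
`i / C(n,2) ≥ θ/2` (`θ = n^{-2/(k-1)}`):
`#slice_{i+K}² · ((i+K)/C(n,2))^K ≤ 2^K·2^K·2^k·k! · #slice_i² · C(n,k)`, from
`C(N,i+K) ≤ C(N,i)·(N/i)^K`, `i + K ≤ 2i` and `C(n,k)·θ^K ≥ 1/(2^k k!)`. [folklore] -/
theorem l23_ratio_le {k i : ℕ} (hk : 2 ≤ k) (hn : 2 * k ≤ n) (hKi : k.choose 2 ≤ i)
    (hθi : (n : ℝ) ^ (-(2 : ℝ) / ((k : ℝ) - 1)) / 2 ≤ (i : ℝ) / n.choose 2) :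
    (#(slice n (i + k.choose 2)) : ℝ) ^ 2 * (((i + k.choose 2 : ℕ) : ℝ) / n.choose 2) ^ k.choose 2 ≤
      2 ^ k.choose 2 * 2 ^ k.choose 2 * 2 ^ k * k.factorial * (#(slice n i) : ℝ) ^ 2 * n.choose k := by
  set K := k.choose 2 with hK
  set N := n.choose 2 with hNdef
  set θ := (n : ℝ) ^ (-(2 : ℝ) / ((k : ℝ) - 1)) with hθ
  have hn1 : 1 ≤ n := by omega
  have hN : 0 < N := Nat.choose_pos (by omega)
  have hN' : (0 : ℝ) < N := by exact_mod_cast hN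
  have hK1 : 1 ≤ K := Nat.choose_pos hk
  have hi : 0 < i := by omega
  have hi' : (0 : ℝ) < i := by exact_mod_cast hi
  have hθ0 : 0 < θ := Real.rpow_pos_of_pos (by exact_mod_cast hn1) _
  set u : ℝ := (i : ℝ) / N with hu
  have hu0 : 0 < u := div_pos hi' hN'
  have hu1 : u ≠ 0 := hu0.ne'
  set a : ℝ := ((#(slice n (i + K)) : ℕ) : ℝ) with ha
  set c : ℝ := ((#(slice n i) : ℕ) : ℝ) with hc
  have ha0 : 0 ≤ a := by rw [ha]; positivity
  -- (1) `a ≤ c / u^K`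
  have h1 : a ≤ c / u ^ K := by
    have hnat := l23_choose_add_mul_pow_le N i K
    have hcs₁ : #(slice n (i + K)) = N.choose (i + K) := Theorems.SliceACZero.Negative.sliceCard_eq n (i + K)
    have hcs₂ : #(slice n i) = N.choose i := Theorems.SliceACZero.Negative.sliceCard_eq n i
    rw [← hcs₁, ← hcs₂] at hnat
    have hreal : a * ((i : ℝ) + 1) ^ K ≤ c * (N : ℝ) ^ K := by
      rw [ha, hc, hNdef]
      exact_mod_cast hnat
    have hiK : (0 : ℝ) < (i : ℝ) ^ K := by positivity
    rw [hu, div_pow, div_div_eq_mul_div, le_div_iff₀ hiK]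
    calc a * (i : ℝ) ^ K ≤ a * ((i : ℝ) + 1) ^ K :=
          mul_le_mul_of_nonneg_left (pow_le_pow_left₀ hi'.le (by linarith) K) ha0
      _ ≤ c * (N : ℝ) ^ K := hreal
  -- (2) `(i + K)/N ≤ 2u`
  have h2 : ((i + K : ℕ) : ℝ) / N ≤ 2 * u := by
    have hle : ((i + K : ℕ) : ℝ) ≤ 2 * i := by
      have : (K : ℝ) ≤ i := by exact_mod_cast hKi
      push_cast
      linarith
    rw [hu, div_le_iff₀ hN']
    calc ((i + K : ℕ) : ℝ) ≤ 2 * i := hle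
      _ = 2 * ((i : ℝ) / N) * N := by field_simp
  -- (3) `1/θ^K ≤ 2^k · k! · C(n,k)`
  have h3 : 1 / θ ^ K ≤ 2 ^ k * k.factorial * n.choose k := by
    have h := le_choose_mul_threshold_pow hk hn (a := 1) zero_le_one
    rw [one_pow, one_mul] at h
    rw [div_le_iff₀ (by positivity)] at h
    rw [div_le_iff₀ (pow_pos hθ0 K)]
    calc (1 : ℝ) ≤ (n.choose k : ℝ) * θ ^ K * (2 ^ k * k.factorial) := h
      _ = 2 ^ k * k.factorial * n.choose k * θ ^ K := by ring
  have hp0 : 0 ≤ ((i + K : ℕ) : ℝ) / N := by positivity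
  have hθ2 : 0 < θ / 2 := by positivity
  calc a ^ 2 * (((i + K : ℕ) : ℝ) / N) ^ K
      ≤ (c / u ^ K) ^ 2 * (2 * u) ^ K := by gcongr
    _ = 2 ^ K * c ^ 2 / u ^ K := by
        field_simp
        ring
    _ ≤ 2 ^ K * c ^ 2 / (θ / 2) ^ K := by gcongr
    _ = 2 ^ K * 2 ^ K * c ^ 2 * (1 / θ ^ K) := by
        rw [div_pow]
        field_simp
    _ ≤ 2 ^ K * 2 ^ K * c ^ 2 * (2 ^ k * k.factorial * n.choose k) := by gcongr
    _ = 2 ^ K * 2 ^ K * 2 ^ k * k.factorial * c ^ 2 * n.choose k := by ring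

/-- **The fibre bound** (steps (4)–(6) of the slice Lemma 23: Cauchy–Schwarz, the second moment of `ω_k`
on the slice `i + C(k,2)`, the slice ratio). In the regime `C(k,2) ≤ i`, `i + C(k,2) ≤ C(n,2)`, `n ≥ 2k`,
`(i + C(k,2))/C(n,2) ≤ 2θ`, `θ/2 ≤ i/C(n,2)`, for every `Q ⊆ slice_{i + C(k,2)}`:
`(Σ_{y ∈ Q} ω_k(y)) / (#slice_i · C(n,k)) ≤ √(L_k · #Q / #slice_{i+C(k,2)})` with
`L_k = (1 + k·2^k·2^{C(k,2)}) · (2^{C(k,2)}·2^{C(k,2)}·2^k·k!)`. [folklore] -/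
theorem l23_fibre_bound {k i : ℕ} (hk : 2 ≤ k) (hn : 2 * k ≤ n) (hKi : k.choose 2 ≤ i)
    (hiN : i + k.choose 2 ≤ n.choose 2)
    (hp : ((i + k.choose 2 : ℕ) : ℝ) / n.choose 2 ≤ 2 * (n : ℝ) ^ (-(2 : ℝ) / ((k : ℝ) - 1)))
    (hθi : (n : ℝ) ^ (-(2 : ℝ) / ((k : ℝ) - 1)) / 2 ≤ (i : ℝ) / n.choose 2)
    {Q : Finset (Edge n → Bool)} (hQ : Q ⊆ slice n (i + k.choose 2)) :
    (∑ y ∈ Q, (#((powersetCard k (univ : Finset (Fin n))).filter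
        fun A => ∀ e, cliqueVec A e = true → y e = true) : ℝ)) / (#(slice n i) * n.choose k) ≤
      Real.sqrt ((1 + k * 2 ^ k * 2 ^ k.choose 2) * (2 ^ k.choose 2 * 2 ^ k.choose 2 * 2 ^ k * k.factorial) *
        ((#Q : ℝ) / #(slice n (i + k.choose 2)))) := by
  set K := k.choose 2 with hK
  set S := slice n i with hS
  set S' := slice n (i + K) with hS'
  set ω : (Edge n → Bool) → ℝ := fun y =>
    #((powersetCard k (univ : Finset (Fin n))).filter fun A => ∀ e, cliqueVec A e = true → y e = true) with hω
  set c₁ : ℝ := 1 + k * 2 ^ k * 2 ^ K with hc₁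
  set R₀ : ℝ := 2 ^ K * 2 ^ K * 2 ^ k * k.factorial with hR₀
  have hn2 : 2 ≤ n := by omega
  have hiN' : i ≤ n.choose 2 := by omega
  have hSpos : (0 : ℝ) < #S := l23_card_slice_cast_pos hiN'
  have hS'pos : (0 : ℝ) < #S' := l23_card_slice_cast_pos hiN
  have hC : (0 : ℝ) < n.choose k := by exact_mod_cast Nat.choose_pos (by omega)
  have hCS : (∑ y ∈ Q, ω y) ^ 2 ≤ #Q * ∑ y ∈ Q, ω y ^ 2 := sq_sum_le_card_mul_sum_sq
  have hmono : ∑ y ∈ Q, ω y ^ 2 ≤ ∑ y ∈ S', ω y ^ 2 :=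
    sum_le_sum_of_subset_of_nonneg hQ fun _ _ _ => sq_nonneg _
  have hM : ∑ y ∈ S', ω y ^ 2 ≤ #S' * (((i + K : ℕ) : ℝ) / n.choose 2) ^ K * (n.choose k * c₁) := by
    have h := l23_secondMoment_le (m := i + K) hk hn2 hiN (b := 2) (by norm_num) hp
    simpa only [hω, hc₁] using h
  have hR : (#S' : ℝ) ^ 2 * (((i + K : ℕ) : ℝ) / n.choose 2) ^ K ≤ R₀ * (#S : ℝ) ^ 2 * n.choose k :=
    l23_ratio_le hk hn hKi hθi
  have key : (∑ y ∈ Q, ω y) ^ 2 * #S' ≤ c₁ * R₀ * #Q * ((#S : ℝ) * n.choose k) ^ 2 := by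
    calc (∑ y ∈ Q, ω y) ^ 2 * #S' ≤ (#Q * ∑ y ∈ S', ω y ^ 2) * #S' := by
          refine mul_le_mul_of_nonneg_right (hCS.trans ?_) hS'pos.le
          exact mul_le_mul_of_nonneg_left hmono (Nat.cast_nonneg _)
      _ ≤ (#Q * (#S' * (((i + K : ℕ) : ℝ) / n.choose 2) ^ K * (n.choose k * c₁))) * #S' := by gcongr
      _ = #Q * n.choose k * c₁ * ((#S' : ℝ) ^ 2 * (((i + K : ℕ) : ℝ) / n.choose 2) ^ K) := by ring
      _ ≤ #Q * n.choose k * c₁ * (R₀ * (#S : ℝ) ^ 2 * n.choose k) := by gcongr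
      _ = c₁ * R₀ * #Q * ((#S : ℝ) * n.choose k) ^ 2 := by ring
  apply Real.le_sqrt_of_sq_le
  rw [div_pow, div_le_iff₀ (by positivity)]
  rw [show c₁ * R₀ * ((#Q : ℝ) / #S') * ((#S : ℝ) * n.choose k) ^ 2 =
      c₁ * R₀ * #Q * ((#S : ℝ) * n.choose k) ^ 2 / #S' by ring]
  rw [le_div_iff₀ hS'pos]
  exact key


end Summit.PneNP.PneNP.Cruxes.ConstantBand.FlatPriorRelativeMinterms

end
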